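import Summits.CriticalPhenomena.PercolationContinuityZ3.Theorems.Transplant.PlanarCells2LevelsT
import Summits.CriticalPhenomena.PercolationContinuityZ3.Theorems.Transplant.PlanarCells2FaceRows
import HarnessLib

/-!
(R-40) SUCCESSOR `…T` (hp-8 g42, 2026-08-23; ruling p3-g16 06:23:56Z, J18): the twin of `PlanarCells2BoundsS` over the PER-AXIS creep cap `PCells2T` (PlanarCells2TDefs:
`c i ≤ r (oth i)` instead of the uniform `c i ≤ cmax ≤ r j`); statements and proofs VERBATIM with `PCells2S ↦ PCells2T` (+ the renames of record of the T layer below it);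
the only mathematical touch points are the places that read the cap, which only ever need the cross form `c (oth j) ≤ r j` (listed in the lane line of this file's landing).
NO landed file is edited; `PlanarCells2BoundsS` stays valid (and is an instance of this file through `PCells2S.toT`). NON-VACUITY: inherited verbatim from `PlanarCells2BoundsS` (same witness line).

# STAGGERED two-unit planar cells `PCells2T`: two planar read-outs the (F) face column needs over the staggered centres (hp-8 g40's request,
# lane INBOX 2026-08-22T23:48:17Z) — the planar diameter of the far region of record `FarNS` and the shifted face row of a stub point

WAVE-1 Geom re-base (typer p3-g15).  `sub_mem_box_of_mem_FarNS` is `Skelφ.sub_mem_box_of_mem_EfarN` (SkelPhiConcFaceStep :49) over `FarNS` via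
`FarNS_subset_abox` (PlanarCells2LevelsS); `mem_faceRow_of_mem_Stub` is PlanarCells2FaceRows :101 verbatim over `cenS` (faces and stubs share the
centre `cenS x`; no creep enters).  Statements in explicit-application form `PCells2T.X P …`.
builds on p205010 (kernel theorem, internal audit signed; external expert review pending) — nothing here uses p205010 or claims anything about the open node.
Lane `prim-bschramm`, seat `prim-bschramm-p3` (gen 15; N2 design owner); helper file (`--supports stmt-CriticalPhenomena-4575 --as helper`).
[cite: KozmaNitzan2024, §4 p. 26 (E^far_{v,x}), p. 30 (F^j)]
-/

noncomputable section

namespace Summit.CriticalPhenomena.PercolationContinuityZ3.Theorems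

namespace Transplant

open Literature.Probability.Percolation Literature.Probability.LatticeModels SimpleGraph GadgetSystem Contour
open Literature.Probability.Percolation.KozmaNitzan
open Literature.Probability.Percolation.KozmaNitzan.Cells (oth oth_ne sgOf sgOf_sign stepVec_apply_fst stepVec_apply_oth eq_oth_of_ne oth_oth)
open PCells (mem_psBox_iff)

namespace PCells2T

variable (P : PCells2T)

/-- **The planar diameter of the far region of record**: two points of `FarNS x du` differ by a vector of `Λ_{50·rmax}` (both lie in
`cenS x + [±25r₀] × [±25r₁]`). [folklore] -/
theorem sub_mem_box_of_mem_FarNS {x : Site 2} {du : MDir} {t t' : Site 2} (ht : t ∈ PCells2T.FarNS P x du) (ht' : t' ∈ PCells2T.FarNS P x du) :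
    t - t' ∈ box 2 (50 * P.rmax) := by
  have h1 := (P.mem_aboxS_iff).1 (P.FarNS_subset_abox x du ht)
  have h2 := (P.mem_aboxS_iff).1 (P.FarNS_subset_abox x du ht')
  rw [mem_box]
  intro i
  have hi1 := h1 i
  have hi2 := h2 i
  have hr : P.r i ≤ P.rmax := P.r_le_rmax i
  have hr' : ((25 * P.r i : ℕ) : ℤ) ≤ 25 * (P.rmax : ℤ) := by exact_mod_cast Nat.mul_le_mul_left 25 hr
  simp only [Pi.sub_apply]
  push_cast at hi1 hi2 hr' ⊢
  constructor <;> linarith [hi1.1, hi1.2, hi2.1, hi2.2]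

/-- The same for the slack far region `FarNS₂ ⊆ FarNS`. [folklore] -/
theorem sub_mem_box_of_mem_FarNS₂ {x : Site 2} {du : MDir} {t t' : Site 2} (ht : t ∈ PCells2T.FarNS₂ P x du) (ht' : t' ∈ PCells2T.FarNS₂ P x du) :
    t - t' ∈ box 2 (50 * P.rmax) :=
  P.sub_mem_box_of_mem_FarNS (P.FarNS₂_subset_FarNS x du ht) (P.FarNS₂_subset_FarNS x du ht')

/-- A stub point at planar level `faceL j` lies in the shifted face row about the staggered centre. [folklore] -/
theorem mem_faceRow_of_mem_Stub {x : Site 2} {du : MDir} {j j' : ℕ} {t : Site 2} (ht : t ∈ PCells2T.Stub P x du j')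
    (hl : PCells2T.lev P du x t = P.faceL du.1 j) : t ∈ Finset.Icc (P.faceLo x du j) (P.faceHi x du j) := by
  rw [Stub, mem_psBox_iff] at ht
  rw [Icc_faceLo_faceHi, mem_psBox_iff]
  unfold lev at hl
  exact ⟨⟨le_of_eq hl.symm, le_of_eq hl⟩, ht.2⟩

/-- Points of the shifted face row have level exactly `faceL j`. [folklore] -/
theorem lev_eq_faceL_of_mem_faceRow {x : Site 2} {du : MDir} {j : ℕ} {t : Site 2} (ht : t ∈ Finset.Icc (P.faceLo x du j) (P.faceHi x du j)) :
    PCells2T.lev P du x t = P.faceL du.1 j := by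
  rw [Icc_faceLo_faceHi, mem_psBox_iff] at ht
  unfold lev
  exact le_antisymm ht.1.2 ht.1.1

/-- The shifted face row lies in the stub `H^{j+1}`. [folklore] -/
theorem faceRow_subset_Stub_succ (x : Site 2) (du : MDir) (j : ℕ) :
    Finset.Icc (P.faceLo x du j) (P.faceHi x du j) ⊆ PCells2T.Stub P x du (j + 1) := by
  rw [Icc_faceLo_faceHi, Stub]
  have h := P.toPCells2.faceL_eq du.1 j
  have hs1 : (1 : ℤ) ≤ P.s du.1 := by exact_mod_cast P.hs du.1
  refine sBox_mono (sgOf_sign du) _ ?_ ?_ le_rfl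
  · rw [h]; nlinarith
  · rw [h]; push_cast; nlinarith

/-- The shifted face row lies in the full corridor when `j + 1 ≤ K`. [folklore] -/
theorem faceRow_subset_Hfull (x : Site 2) (du : MDir) {j : ℕ} (hj : j + 1 ≤ P.K) :
    Finset.Icc (P.faceLo x du j) (P.faceHi x du j) ⊆ PCells2T.Hfull P x du :=
  (P.faceRow_subset_Stub_succ x du j).trans (P.Stub_subset_Hfull x du hj)

end PCells2T

end Transplant

end Summit.CriticalPhenomena.PercolationContinuityZ3.Theorems

end
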